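/-
Copyright (c) 2026 the pub-hodgecm-mathlib formalisation cell (harness21).  Prover seat hodgecm-mathlib-LH4-p12 (g7), req620 Track A «(D-RAM) FOUR-FRAME» squad — STAGE-1b
directive draft v1∕v2 §3: FIRST HAND on `stub_law_sq`, step (S2c) «THE COMPOSITION ENGINE» (the two labelled END statements (S2a-κ)∕(S2b-κS) as binders).  Helper lane
`--supports stmt-HodgeConjecture-24833`.  2026-09-04.
-/
import Summits.HodgeConjecture.HodgeConjecture.Theorems.F0P3cDyRamLevelsKappaSignLawOfLabelledModelSum     -- ★ p859535 (this seat): (S1) `fencedSqKappaSignSlot_of_labelledModelSum`; brings ★ №1-R2, `normIndexTwo`, census DEFS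
import Summits.HodgeConjecture.HodgeConjecture.Theorems.F0P3cDyRamKappaSignModelSumTokenOfKappaStageB     -- ★ (LH4-p05 (g4)): the UNIT engine (template); brings ★ `not_exists_mul_map_eq_of_dichotomy`, `v_vecCons_eq_one_of_isElementDatum`, `vecCons_injective_of_isElementDatum`, `kappaCount`, `stabiliserWeight`, `normalisedStableLattices`
import HarnessLib

/-!
# Crux `H413`, line LH4 «(D-RAM) FOUR-FRAME» road, STAGE 1b — (S2c) THE COMPOSITION ENGINE FOR `stub_law_sq`: the LABELLED κ-Stage A₀ (S2a-κ) and the LABELLED signed κ-Stage B₀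
# (S2b-κS) ⟹ the Ω-aware eightfold labelled κ-model sum (sq-KSS²) ⟹ (★ p859535) the fenced square-level κ-law slot — type 0 only, the square-level token riding along

Cell `hodgecm-mathlib` (D-0151), FLOOR 0, crux item H413 = `stmt-HodgeConjecture-24833`, route of record `HCCMUnconditional`; squad F0∕P3c∕LH4 (req618∕req620).
THEOREMS ONLY (no `def`, no instance, no notation, no `sorry`, default heartbeats); lane `--supports stmt-HodgeConjecture-24833 --as helper` (count-neutral).

WHAT IS PROVED — the LABELLED, TYPE-0-ONLY twin of ★ `F0P3cDyRamKappaSignModelSumTokenOfKappaStageB.kappaSignModelSum_of_kappaStageB_token` (the unit's (KSS²) engine), with the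
square-level token `D²·M ⊆ ϖ^{lb d}·M` (`D² = diag((a²−1)², (b²−1)², 0)`) riding in every set-builder:
* **`sqKappaSignModelSum2_of_labelledKappaStageB (Ω) (lb) (A) (hAκ0sq) (hBκS0sq)`** — GIVEN
  (S2a-κ) «LABELLED κ-STAGE A₀»: for a regular unit diagonal `T = diag(s)`, a `σ`-fixed NON-norm unit `c` with the index-two dichotomy, every slot `i`, EVERY level `m` and EVERY diagonal label
  operator `diag(e)`: `Σ_{e′ : Fin 3 → Bool} χ⁰_i(e′)·#{M : type-0 for diag(d_{e′}), T·M = M, diag(e)·M ⊆ ϖ^m M} = 8·Σᶠ_{M₀ ∈ 𝓛₀(T), dualisable, diag(e)·M₀ ⊆ ϖ^m M₀} κ₀,ᵢ(M₀)·w(M₀)`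
  (the labelled twin of ★ p856579 `cast_sum_signChar_mul_ncard_eq_eight_mul_finsum_kappaCount_zero`; the label is `diag(z)`-invariant, LH4-p09 (g8) ★ `latticeInLevel_mapGL_diagGLUnits_iff`), and
  (S2b-κS) «LABELLED SIGNED κ-STAGE B₀»: at every wild datum, square element datum `(a², b²; n)` at `depthOfRecord d`, `T = diag(a², b², 1)`, `2k + d = Σn + 2`, slot `i`, `2B = n_i − d + 2 −
  2·shiftR d t`:  `Σᶠ_{M ∈ 𝓛₀(T), dualisable, D²·M ⊆ ϖ^{lb d}M} κ₀,ᵢ(M)·w(M) = (Ω_i·w_i·S_i)·A(q, d, t, k, B)∕4` (the labelled twin of ★ p857128 `kappaSignCount2_typeZero`) —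
  THEN (sq-KSS²), the `hSKSS` binder of ★ p859535 `fencedSqKappaSignSlot_of_labelledModelSum shiftR Ω depthOfRecord lb A`, holds for every `K`.
* **`fencedSqKappaSignSlot_of_labelledKappaStageB`** — ∘ ★ p859535: (S2a-κ) + (S2b-κS) ⟹ the FENCED SQUARE-LEVEL LAW SLOT `hL` of ★ `F0P3cDyRamTierZeroRowsTwoThreeOfLevels.pieceRowsWild_gselStar_three_of_fencedLaw_of_hside`
  at `(shiftR, Ω, depthOfRecord, lb, A)` — at `(omegaR, mstarOfRecord, amplSq)` this IS the tier-0 ED. 5 stub `stub_law_sq` (directive draft v2 §2) MODULO EXACTLY the two labelled census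
  statements (S2a-κ), (S2b-κS), whose END names are thereby fixed for the hands the dealer names (draft §3; LH4-p09 (g8) labelled engine ★ p858820∕`LevelSumSignClasses`∕`Labelled*`).
NOTHING IS CLAIMED ABOUT (S2a-κ) OR (S2b-κS): they are BINDERS (prover targets).  HONEST LABEL.  Count-neutral helper: states no law, pays no stub; tier-0 rows T₊∕T₋∕regular OPEN; `HC_CM` is
proved only modulo the 7 printed citations (2 remaining named inputs: hLiu418 = `stmt-HodgeConjecture-24832`, h413 = `stmt-HodgeConjecture-24833`) until rung 0 closes.

## References
* [Kottwitz1986BaseChangeUnits] R. E. Kottwitz, *Base change for unit elements of Hecke algebras*, Compositio Math. 60 (1986), §1 pp. 240–241.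
* [Rogawski1990] J. D. Rogawski, *Automorphic Representations of Unitary Groups in Three Variables*, Ann. of Math. Stud. 123 (1990), §4.9 Prop. 4.9.1 (a) p. 55, §4.10 p. 58.
* [LanglandsShelstad1987] R. P. Langlands, D. Shelstad, *On the definition of transfer factors*, Math. Ann. 278 (1987), §1.3, §3.
-/

set_option autoImplicit false

noncomputable section

namespace Summit.HodgeConjecture.HodgeConjecture.Cruxes.H413.F0P3cDyRamSqKappaSignModelSumOfLabelledStageB

open scoped Valued WithZero Matrix MatrixGroups
open Literature.NumberTheory.Automorphic Literature.NumberTheory.Automorphic.HermitianLattice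
open Literature.NumberTheory.Automorphic.UnitaryLatticeTree Literature.NumberTheory.Automorphic.UnitaryThreeFourFrame
open Summit.HodgeConjecture.HodgeConjecture.Cruxes.H413.F0P3cDyRamFourFrameLawDefs
open Summit.HodgeConjecture.HodgeConjecture.Cruxes.H413.F0P3cDyRamFourFrameLawDefsR
open Summit.HodgeConjecture.HodgeConjecture.Cruxes.H413.F0P3cDyRamFourFrameLawDefsR2
open Summit.HodgeConjecture.HodgeConjecture.Cruxes.H413.F0P3cDyRamFourFrameCensusDefs
open Summit.HodgeConjecture.HodgeConjecture.Cruxes.H413.F0P3cDyRamDiagonalTorusDefs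
open Summit.HodgeConjecture.HodgeConjecture.Cruxes.H413.F0P3cDyRamDiagonalStrataDefs
open Summit.HodgeConjecture.HodgeConjecture.Cruxes.H413.F0P3cDyRamDiagonalKappaCountDefs
open Summit.HodgeConjecture.HodgeConjecture.Cruxes.H413.F0P3cDyRamStableModelSumOfStageB
open Summit.HodgeConjecture.HodgeConjecture.Cruxes.H413.F0P3cDyRamLevelsKappaSignLawOfLabelledModelSum

/-- **(S2c) THE COMPOSITION ENGINE** — labelled κ-Stage A₀ (S2a-κ) + labelled signed κ-Stage B₀ (S2b-κS) ⟹ the Ω-aware eightfold LABELLED κ-model sum (sq-KSS²) for every `K`, in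
the exact shape of ★ p859535 `fencedSqKappaSignSlot_of_labelledModelSum`'s binder `hSKSS` at `(shiftR, Ω, depthOfRecord, lb, A)`.  Proof = ★ `kappaSignModelSum_of_kappaStageB_token`'s
type-0 branch with the label riding along: `c` is a non-norm (★ `not_exists_mul_map_eq_of_dichotomy`), `(a², b², 1)` is a regular unit diagonal (★ `v_vecCons_eq_one_of_isElementDatum`,
★ `vecCons_injective_of_isElementDatum`), then `8·(S·A∕4) = 2·S·A`. [cite: Kottwitz1986BaseChangeUnits, §1 pp. 240–241] [cite: Rogawski1990, §4.9 Prop. 4.9.1 (a) p. 55] [cite: LanglandsShelstad1987, §1.3] -/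
theorem sqKappaSignModelSum2_of_labelledKappaStageB (Ω : OmegaSchedule) (lb : ℕ → ℕ) (A : ℕ → ℕ → ℕ → ℕ → ℤ → ℚ)
    (hAκ0sq : ∀ {K : Type} [Field K] [Valued K ℤᵐ⁰] [Finite 𝓀[K]] {σ : K →+* K}, (∀ x, σ (σ x) = x) → (∀ a, Valued.v (σ a) = Valued.v a) →
      ∀ {ϖ : K}, Valued.v ϖ = WithZero.exp (-1 : ℤ) → ∀ (ϖu : Kˣ), (ϖu : K) = ϖ →
      ∀ {c : K}, σ c = c → Valued.v c = 1 → (¬ ∃ z : K, z * σ z = c) →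
        (∀ x : K, σ x = x → x ≠ 0 → (∃ z : K, z * σ z = x) ∨ ∃ z : K, z * σ z = c * x) →
      ∀ {s : Fin 3 → K}, (∀ i, Valued.v (s i) = 1) → (∀ i j, i ≠ j → s i ≠ s j) →
      ∀ (T : GL (Fin 3) K), (T : Matrix (Fin 3) (Fin 3) K) = Matrix.diagonal s → ∀ (i : Fin 3) (m : ℕ) (e : Fin 3 → K),
        (((∑ e' : Fin 3 → Bool,
            (![(if e' 1 then -1 else 1) * (if e' 2 then -1 else 1),
               (if e' 0 then -1 else 1) * (if e' 2 then -1 else 1),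
               (if e' 0 then -1 else 1) * (if e' 1 then -1 else 1)] : Fin 3 → ℤ) i *
              ({M : Submodule 𝒪[K] (Fin 3 → K) |
                IsVertexLattice σ ϖ (Matrix.diagonal fun j => if e' j then c else (1 : K)) 0 M ∧ mapGL T M = M ∧
                  LatticeInLevel ϖ m (Matrix.diagonal e) M}.ncard : ℤ) : ℤ) : ℚ)) =
          8 * ∑ᶠ M₀ ∈ {M : Submodule 𝒪[K] (Fin 3 → K) | M ∈ normalisedStableLattices T ∧ IsDualisableLattice σ ϖ M ∧ LatticeInLevel ϖ m (Matrix.diagonal e) M},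
            (kappaCount σ ϖ 0 i M₀ : ℚ) * stabiliserWeight σ M₀)
    (hBκS0sq : ∀ {K : Type} [Field K] [Valued K ℤᵐ⁰] [CompleteSpace K] [Fintype 𝓀[K]] {σ : K →+* K} {ϖ : K} {d t : ℕ}, IsRamifiedQuadraticDatum σ ϖ d t →
      Valued.v (2 : K) < 1 → ∀ {δ : K}, σ δ = -δ → δ ≠ 0 →
      ∀ {a b : K}, a * σ a = 1 → b * σ b = 1 → Valued.v (a - 1) < Valued.v (2 : K) → Valued.v (b - 1) < Valued.v (2 : K) →
      ∀ {n₁ n₂ n₃ : ℕ}, IsElementDatum σ ϖ (depthOfRecord d) (a * a) (b * b) n₁ n₂ n₃ →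
      ∀ (T : GL (Fin 3) K), (T : Matrix (Fin 3) (Fin 3) K) = Matrix.diagonal ![a * a, b * b, 1] → ∀ (k : ℕ), 2 * k + d = n₁ + n₂ + n₃ + 2 →
      ∀ (i : Fin 3) (B : ℤ), 2 * B = ((![n₁, n₂, n₃] : Fin 3 → ℕ) i : ℤ) - d + 2 - 2 * shiftR d t →
        ∑ᶠ M ∈ {M : Submodule 𝒪[K] (Fin 3 → K) | M ∈ normalisedStableLattices T ∧ IsDualisableLattice σ ϖ M ∧
            LatticeInLevel ϖ (lb d) (Matrix.diagonal ![(a * a - 1) * (a * a - 1), (b * b - 1) * (b * b - 1), 0]) M},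
            (kappaCount σ ϖ 0 i M : ℚ) * stabiliserWeight σ M =
          ((Ω K σ ϖ d a b i * ((![normSign σ (-1 : K), normSign σ (-1 : K), 1] : Fin 3 → ℤ) i *
            (baseSign σ i * normSign σ (fPartProd δ ![a, b, 1] i))) : ℤ) : ℚ) * A (Fintype.card 𝓀[K]) d t k B / 4)
    {K : Type} [Field K] [Valued K ℤᵐ⁰] [CompleteSpace K] [Fintype 𝓀[K]] (σ : K →+* K) (ϖ : K) (d t : ℕ) :
    Valued.v (2 : K) < 1 → IsRamifiedQuadraticDatum σ ϖ d t →
      ∀ c : K, σ c = c → Valued.v c = 1 → (∀ x : K, σ x = x → x ≠ 0 → (∃ z : K, z * σ z = x) ∨ ∃ z : K, z * σ z = c * x) →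
      ∀ (δ : K), σ δ = -δ → δ ≠ 0 →
      ∀ (a b : K), a * σ a = 1 → b * σ b = 1 → Valued.v (a - 1) < Valued.v (2 : K) → Valued.v (b - 1) < Valued.v (2 : K) →
      ∀ (n₁ n₂ n₃ : ℕ), IsElementDatum σ ϖ (depthOfRecord d) (a * a) (b * b) n₁ n₂ n₃ →
      ∀ (T : GL (Fin 3) K), (T : Matrix (Fin 3) (Fin 3) K) = Matrix.diagonal ![a * a, b * b, 1] →
      ∀ (k : ℕ), 2 * k + d = n₁ + n₂ + n₃ + 2 →
      ∀ (i : Fin 3) (B : ℤ), 2 * B = ((![n₁, n₂, n₃] : Fin 3 → ℕ) i : ℤ) - d + 2 - 2 * shiftR d t →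
        ((∑ s : Fin 3 → Bool,
            (![(if s 1 then -1 else 1) * (if s 2 then -1 else 1),
               (if s 0 then -1 else 1) * (if s 2 then -1 else 1),
               (if s 0 then -1 else 1) * (if s 1 then -1 else 1)] : Fin 3 → ℤ) i *
              ({M : Submodule 𝒪[K] (Fin 3 → K) |
                IsVertexLattice σ ϖ (Matrix.diagonal fun j => if s j then c else (1 : K)) 0 M ∧ mapGL T M = M ∧
                  LatticeInLevel ϖ (lb d) (Matrix.diagonal ![(a * a - 1) * (a * a - 1), (b * b - 1) * (b * b - 1), 0]) M}.ncard : ℤ) : ℤ) : ℚ) =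
          2 * ((Ω K σ ϖ d a b i * ((![normSign σ (-1 : K), normSign σ (-1 : K), 1] : Fin 3 → ℤ) i *
            (baseSign σ i * normSign σ (fPartProd δ ![a, b, 1] i))) : ℤ) : ℚ) * A (Fintype.card 𝓀[K]) d t k B := by
  intro h2 hD c hσc hcv hdich δ hδ hδ0 a b ha hb ha2 hb2 n₁ n₂ n₃ hE T hT k hk i B hB
  have hσ : ∀ x, σ (σ x) = x := hD.1
  have hvσ : ∀ a, Valued.v (σ a) = Valued.v a := hD.2.1
  have hϖ : Valued.v ϖ = WithZero.exp (-1 : ℤ) := hD.2.2.1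
  have hc : ¬ ∃ z : K, z * σ z = c := not_exists_mul_map_eq_of_dichotomy hD h2 hcv hdich
  have hs := v_vecCons_eq_one_of_isElementDatum hvσ hE
  have hreg := vecCons_injective_of_isElementDatum hE
  have hϖ0 : ϖ ≠ 0 := (Valuation.ne_zero_iff _).1 (by rw [hϖ]; exact WithZero.exp_ne_zero)
  have h8 : ∀ (X S' A' : ℚ), X = S' * A' / 4 → 8 * X = 2 * S' * A' := fun X S' A' h => by rw [h]; ring
  rw [hAκ0sq hσ hvσ hϖ (Units.mk0 ϖ hϖ0) rfl hσc hcv hc hdich hs hreg T hT i (lb d) _]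
  exact h8 _ _ _ (hBκS0sq hD h2 hδ hδ0 ha hb ha2 hb2 hE T hT k hk i B hB)

/-- **(S2a-κ) + (S2b-κS) ⟹ THE FENCED SQUARE-LEVEL κ-LAW SLOT** (∘ ★ p859535 `fencedSqKappaSignSlot_of_labelledModelSum`): at `(shiftR, Ω, depthOfRecord, lb, A)`, for every `K`, the
`hL` letter of ★ `…TierZeroRowsTwoThreeOfLevels.pieceRowsWild_gselStar_three_of_fencedLaw_of_hside` — so the tier-0 ED. 5 stub `stub_law_sq` (= this at `(omegaR, mstarOfRecord, amplSq)`)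
is reduced to EXACTLY the two labelled census statements.  Nothing is claimed about them. [cite: Rogawski1990, §4.9 Prop. 4.9.1 (a) p. 55] [cite: LanglandsShelstad1987, §1.3] -/
theorem fencedSqKappaSignSlot_of_labelledKappaStageB (Ω : OmegaSchedule) (lb : ℕ → ℕ) (A : ℕ → ℕ → ℕ → ℕ → ℤ → ℚ)
    (hAκ0sq : ∀ {K : Type} [Field K] [Valued K ℤᵐ⁰] [Finite 𝓀[K]] {σ : K →+* K}, (∀ x, σ (σ x) = x) → (∀ a, Valued.v (σ a) = Valued.v a) →
      ∀ {ϖ : K}, Valued.v ϖ = WithZero.exp (-1 : ℤ) → ∀ (ϖu : Kˣ), (ϖu : K) = ϖ →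
      ∀ {c : K}, σ c = c → Valued.v c = 1 → (¬ ∃ z : K, z * σ z = c) →
        (∀ x : K, σ x = x → x ≠ 0 → (∃ z : K, z * σ z = x) ∨ ∃ z : K, z * σ z = c * x) →
      ∀ {s : Fin 3 → K}, (∀ i, Valued.v (s i) = 1) → (∀ i j, i ≠ j → s i ≠ s j) →
      ∀ (T : GL (Fin 3) K), (T : Matrix (Fin 3) (Fin 3) K) = Matrix.diagonal s → ∀ (i : Fin 3) (m : ℕ) (e : Fin 3 → K),
        (((∑ e' : Fin 3 → Bool,
            (![(if e' 1 then -1 else 1) * (if e' 2 then -1 else 1),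
               (if e' 0 then -1 else 1) * (if e' 2 then -1 else 1),
               (if e' 0 then -1 else 1) * (if e' 1 then -1 else 1)] : Fin 3 → ℤ) i *
              ({M : Submodule 𝒪[K] (Fin 3 → K) |
                IsVertexLattice σ ϖ (Matrix.diagonal fun j => if e' j then c else (1 : K)) 0 M ∧ mapGL T M = M ∧
                  LatticeInLevel ϖ m (Matrix.diagonal e) M}.ncard : ℤ) : ℤ) : ℚ)) =
          8 * ∑ᶠ M₀ ∈ {M : Submodule 𝒪[K] (Fin 3 → K) | M ∈ normalisedStableLattices T ∧ IsDualisableLattice σ ϖ M ∧ LatticeInLevel ϖ m (Matrix.diagonal e) M},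
            (kappaCount σ ϖ 0 i M₀ : ℚ) * stabiliserWeight σ M₀)
    (hBκS0sq : ∀ {K : Type} [Field K] [Valued K ℤᵐ⁰] [CompleteSpace K] [Fintype 𝓀[K]] {σ : K →+* K} {ϖ : K} {d t : ℕ}, IsRamifiedQuadraticDatum σ ϖ d t →
      Valued.v (2 : K) < 1 → ∀ {δ : K}, σ δ = -δ → δ ≠ 0 →
      ∀ {a b : K}, a * σ a = 1 → b * σ b = 1 → Valued.v (a - 1) < Valued.v (2 : K) → Valued.v (b - 1) < Valued.v (2 : K) →
      ∀ {n₁ n₂ n₃ : ℕ}, IsElementDatum σ ϖ (depthOfRecord d) (a * a) (b * b) n₁ n₂ n₃ →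
      ∀ (T : GL (Fin 3) K), (T : Matrix (Fin 3) (Fin 3) K) = Matrix.diagonal ![a * a, b * b, 1] → ∀ (k : ℕ), 2 * k + d = n₁ + n₂ + n₃ + 2 →
      ∀ (i : Fin 3) (B : ℤ), 2 * B = ((![n₁, n₂, n₃] : Fin 3 → ℕ) i : ℤ) - d + 2 - 2 * shiftR d t →
        ∑ᶠ M ∈ {M : Submodule 𝒪[K] (Fin 3 → K) | M ∈ normalisedStableLattices T ∧ IsDualisableLattice σ ϖ M ∧
            LatticeInLevel ϖ (lb d) (Matrix.diagonal ![(a * a - 1) * (a * a - 1), (b * b - 1) * (b * b - 1), 0]) M},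
            (kappaCount σ ϖ 0 i M : ℚ) * stabiliserWeight σ M =
          ((Ω K σ ϖ d a b i * ((![normSign σ (-1 : K), normSign σ (-1 : K), 1] : Fin 3 → ℤ) i *
            (baseSign σ i * normSign σ (fPartProd δ ![a, b, 1] i))) : ℤ) : ℚ) * A (Fintype.card 𝓀[K]) d t k B / 4)
    {K : Type} [Field K] [Valued K ℤᵐ⁰] [CompleteSpace K] [Fintype 𝓀[K]] (σ : K →+* K) (ϖ : K) (d t : ℕ) :
    Valued.v (2 : K) < 1 → IsRamifiedQuadraticDatum σ ϖ d t →
      ∀ (f : Fin 4 → Fin 3 → (Fin 3 → K)), IsFourFrameFamily σ f →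
      ∀ (δ : K), σ δ = -δ → δ ≠ 0 →
      ∀ (a b : K), a * σ a = 1 → b * σ b = 1 → Valued.v (a - 1) < Valued.v (2 : K) → Valued.v (b - 1) < Valued.v (2 : K) →
      ∀ (n₁ n₂ n₃ : ℕ), IsElementDatum σ ϖ (depthOfRecord d) (a * a) (b * b) n₁ n₂ n₃ →
      ∀ (Γ : Fin 4 → GL (Fin 3) K), (∀ b', (Γ b' : Matrix (Fin 3) (Fin 3) K) = frameElt σ f b' (a * a) (b * b)) →
      ∀ (k : ℕ), 2 * k + d = n₁ + n₂ + n₃ + 2 →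
      ∀ (i : Fin 3) (B : ℤ), 2 * B = ((![n₁, n₂, n₃] : Fin 3 → ℕ) i : ℤ) - d + 2 - 2 * shiftR d t →
        ((∑ b' : Fin 4, kappaChar i b' * ({M : Submodule (Valued.integer K) (Fin 3 → K) | IsVertexLattice σ ϖ ((StdForm.antidiagonal 3).over K) 0 M ∧ mapGL (Γ b') M = M ∧
            LatticeInLevel ϖ (lb d) (((Γ b' : Matrix (Fin 3) (Fin 3) K) - 1) * ((Γ b' : Matrix (Fin 3) (Fin 3) K) - 1)) M}.ncard : ℤ) : ℤ) : ℚ) =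
          (Ω K σ ϖ d a b i * (baseSign σ i * normSign σ (fPartProd δ ![a, b, 1] i)) : ℤ) * A (Fintype.card 𝓀[K]) d t k B :=
  fencedSqKappaSignSlot_of_labelledModelSum shiftR Ω depthOfRecord lb A
    (fun σ ϖ d t h2 hD c hσc hcv hdich δ hδ hδ0 a b ha hb ha2 hb2 n₁ n₂ n₃ hE T hT k hk i B hB =>
      sqKappaSignModelSum2_of_labelledKappaStageB Ω lb A hAκ0sq hBκS0sq σ ϖ d t h2 hD c hσc hcv hdich δ hδ hδ0 a b ha hb ha2 hb2 n₁ n₂ n₃ hE T hT k hk i B hB)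
    σ ϖ d t

end Summit.HodgeConjecture.HodgeConjecture.Cruxes.H413.F0P3cDyRamSqKappaSignModelSumOfLabelledStageB

end
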